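import Literature.Analysis.FunctionSpaces.TorusMollifiedFields
import Mathlib.Analysis.Normed.Operator.Prod
import HarnessLib

/-!
# Space–time mollification on `ℝ × T^d`: evenness and adjointness of the torus mollifier, smoothness of space–time convolutions

Analysis/FunctionSpaces support file (serves the discharge of the mollified energy balance, step
(11) of Cheskidov–Constantin–Friedlander–Shvydkoy 2008, §3.2, in the decomposition of the sharp
Onsager rigidity theorem `Literature.Analysis.FluidPDE.onsager_rigidity_ccfs`
(`Literature/Analysis/FluidPDE/OnsagerCCFSFlux`, named fact
`Torus.IsWeakEulerSolutionOn.energyBalance_vecConv`): the weak formulation of the Euler equations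
on `T^d × (0,T)` is tested with a space–time mollification of the solution, which has to be an
honest smooth space–time test field. Everything is proved.

* `Torus.integral_mul_convolution_comm` — mollification by an even kernel (such as the torus
  mollifier: `Torus.kernel_neg`, `FunctionSpaces/TorusMollifierEstimates`) is symmetric,
  `∫ f (g ⋆ K) = ∫ (f ⋆ K) g` (Fubini on `T^d × T^d`).
* `Torus.stConv η k F` — **space–time mollification** `(t, x) ↦ ∫∫ F(s,z) η(t-s) k(x-z) ds dz`
  of `F ∈ L¹(ℝ × T^d)` by a product kernel; `Torus.hasFDerivAt_stLift_stConv` (differentiation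
  under the integral sign, Mathlib's `hasFDerivAt_integral_of_dominated_of_fderiv_le`, through
  the Euclidean product kernel `Torus.stProdKernel` and its derivative `Torus.stProdKernelDeriv`),
  `Torus.fderiv_stLift_stConv_apply` (directional derivatives are again space–time
  mollifications, kernels `(η, ∂ᵥk)` and `(η', k)`), and **smoothness**
  `Torus.contDiff_top_stLift_stConv`: the space–time lift of `stConv η k F` is `C^∞` for
  `η ∈ C_c^∞(ℝ)`, `k` smooth — the induction of the accepted `Torus.contDiff_lift_convolution`
  one dimension up; derivative formulas `Torus.timeDeriv_stConv` (`∂ₜ = η' ⊗ k`) and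
  `Torus.partialDeriv_stConv` (`∂ᵢ = η ⊗ ∂ᵢk`).
* `Torus.convolution_partialDeriv_right` — `f ⋆ ∂ᵢK = (∂ᵢf) ⋆ K` for smooth `f` (integration by
  parts on `T^d`); `Torus.IsDivFree.vecConv` — mollifying a smooth divergence-free field
  componentwise gives a divergence-free field.
* `Torus.timeConv_spaceConv_comm`, `Torus.stConv_eq_timeConv` — Fubini identities between time
  mollification (Mathlib convolution on `ℝ`) and space mollification (Mathlib convolution on
  `T^d`).
* `Torus.hasDerivAt_integral_sq` — chain rule `d/ds ∫ V(s,x)² dx = ∫ 2 V ∂ₛV` for fields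
  smooth and bounded in time.

## Relation to the tree

The sibling definitions file `FunctionSpaces/TorusMollifiedFields` (route `onsager_rigidity`,
Constantin–E–Titi) fixes the same operations in curried form: its `timeAvgWith r G t x =
(r ⋆ G(·, x))(t)` is literally the right-hand side of `Torus.stConv_eq_timeConv` and of
`Torus.timeConv_spaceConv_comm` below (restated through it as `Torus.stConv_eq_timeAvgWith` and
`Torus.timeAvgWith_convolution_comm`, so that both routes consume them without unfolding); its
`vecMollify ε u` is the componentwise space mollification whose unfolded body
(`fun x => toLp 2 fun i => ((u · i) ⋆ K) x`, = `OnsagerCCFSFlux.vecConv u K`, which a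
`FunctionSpaces` file cannot import) is the shape on which `Torus.IsDivFree.vecConv` is stated;
its `mollifiedField φ ε U t x i = (timeAvgWith ρ Uᵢ t ⋆ kernel ε) x` is the shape of
`Torus.timeConv_spaceConv_comm`; and its `stKernel r ε (s, v) = r s * profile ε v` (compactly
supported Euclidean profile) is a *different object with the same purpose* as the periodic
product kernel `Torus.stProdKernel η k (s, y) = η s * lift k y` used here to differentiate under
the integral sign. `Torus.contDiff_top_stLift_stConv` is precisely the space–time smoothness that
`TorusMollifiedFields` defers "downstream".

## Mathlib search

Mathlib (this pin) has convolution smoothness on finite-dimensional normed spaces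
(`HasCompactSupport.contDiff_convolution_left/right`) but not on `ℝ × T^d` (the torus is not a
normed space; smoothness is expressed through the periodic lift, `Torus.stLift`); parametric
differentiation (`hasFDerivAt_integral_of_dominated_of_fderiv_le`,
`hasDerivAt_integral_of_dominated_loc_of_deriv_le`), Fubini (`integral_integral_swap`,
`integral_prod`), evenness of normalised bumps (`ContDiffBump.normed_neg`) are Mathlib's.

## References

* A. Cheskidov, P. Constantin, S. Friedlander, R. Shvydkoy, Nonlinearity 21 (2008) =
  arXiv:0704.0759, §3.1 (last paragraph: physical-space mollifications of `u` as test
  functions) and §3.2 (11).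
* L. C. Evans, *Partial Differential Equations*, 2nd ed. (2010), App. C.4, Thm 7.
-/

noncomputable section

open MeasureTheory TopologicalSpace Set Function Filter Topology Metric
open scoped ENNReal NNReal Convolution ContDiff InnerProductSpace

namespace Literature.Analysis.FunctionSpaces

namespace Torus

variable {d : Type*} [Fintype d]

/-! ## Adjointness of mollification by an even kernel -/

section Adjoint

/-- **Mollification by an even kernel is symmetric**: `∫ f (g ⋆ K) = ∫ (f ⋆ K) g` for
integrable real `f`, `g` and a continuous even kernel `K` on `T^d` (Fubini on `T^d × T^d`). [folklore] -/
theorem integral_mul_convolution_comm {f g K : UnitAddTorus d → ℝ} (hf : Integrable f volume)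
    (hg : Integrable g volume) (hK : Continuous K) (hKe : ∀ z, K (-z) = K z) :
    ∫ x, f x * (g ⋆ K) x = ∫ y, (f ⋆ K) y * g y := by
  obtain ⟨C, hC⟩ := exists_forall_norm_le_of_continuous hK
  -- the integrand on the product `T^d × T^d`
  set Φ : UnitAddTorus d × UnitAddTorus d → ℝ := fun p => f p.1 * g p.2 * K (p.1 - p.2) with hΦ
  have hΦi : Integrable Φ (volume.prod volume) := by
    have hprod : Integrable (fun p : UnitAddTorus d × UnitAddTorus d => f p.1 * g p.2)
        (volume.prod volume) := hf.mul_prod hg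
    refine hprod.mul_bdd (hK.comp_aestronglyMeasurable
      (measurable_fst.sub measurable_snd).aestronglyMeasurable) (Eventually.of_forall fun p => hC _)
      |>.congr (Eventually.of_forall fun p => ?_)
    simp only [hΦ]
    rfl
  calc ∫ x, f x * (g ⋆ K) x = ∫ x, ∫ y, Φ (x, y) := by
        refine integral_congr_ae (Eventually.of_forall fun x => ?_)
        show f x * (g ⋆ K) x = ∫ y, Φ (x, y)
        rw [convolution_lsmul, ← integral_const_mul]
        refine integral_congr_ae (Eventually.of_forall fun y => ?_)
        simp only [hΦ, smul_eq_mul]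
        ring
    _ = ∫ y, ∫ x, Φ (x, y) := integral_integral_swap hΦi
    _ = ∫ y, (f ⋆ K) y * g y := by
        refine integral_congr_ae (Eventually.of_forall fun y => ?_)
        show ∫ x, Φ (x, y) = (f ⋆ K) y * g y
        rw [convolution_lsmul, ← integral_mul_const]
        refine integral_congr_ae (Eventually.of_forall fun x => ?_)
        simp only [hΦ, smul_eq_mul]
        rw [← hKe (y - x), neg_sub]
        ring

end Adjoint

/-! ## Space–time mollification on `ℝ × T^d` is smooth -/

section SpaceTimeConv

/-- **Space–time mollification** of `F : ℝ × T^d → ℝ` by the product kernel `η ⊗ k`: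
`(stConv η k F)(t, x) = ∫∫ F(s, z) η(t - s) k(x - z) ds dz` (integral over `ℝ × T^d` with the
product of Lebesgue and Haar probability measure). [folklore] -/
def stConv (η : ℝ → ℝ) (k : UnitAddTorus d → ℝ) (F : ℝ × UnitAddTorus d → ℝ) :
    ℝ → UnitAddTorus d → ℝ :=
  fun t x => ∫ p, F p * (η (t - p.1) * k (x - p.2)) ∂((volume : Measure ℝ).prod volume)

/-- The Euclidean product kernel `(t, y) ↦ η(t) k(proj y)`. [folklore] -/
def stProdKernel (η : ℝ → ℝ) (k : UnitAddTorus d → ℝ) : ℝ × EuclideanSpace ℝ d → ℝ :=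
  fun q => η q.1 * lift k q.2

/-- The derivative of the product kernel. [folklore] -/
def stProdKernelDeriv (η : ℝ → ℝ) (k : UnitAddTorus d → ℝ) (q : ℝ × EuclideanSpace ℝ d) :
    (ℝ × EuclideanSpace ℝ d) →L[ℝ] ℝ :=
  η q.1 • ((_root_.fderiv ℝ (lift k) q.2).comp (ContinuousLinearMap.snd ℝ ℝ (EuclideanSpace ℝ d))) +
    lift k q.2 • (deriv η q.1 • ContinuousLinearMap.fst ℝ ℝ (EuclideanSpace ℝ d))

variable {η : ℝ → ℝ} {k : UnitAddTorus d → ℝ} {F : ℝ × UnitAddTorus d → ℝ}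

/-- The space–time lift of a space–time mollification through the centred fundamental domain. [folklore] -/
theorem stLift_stConv (η : ℝ → ℝ) (k : UnitAddTorus d → ℝ) (F : ℝ × UnitAddTorus d → ℝ) :
    stLift (stConv η k F) = fun q =>
      ∫ p, F p * stProdKernel η k (q - (p.1, reprc p.2)) ∂((volume : Measure ℝ).prod volume) := by
  funext q
  simp only [stLift, stConv, stProdKernel, Prod.fst_sub, Prod.snd_sub, lift_apply, proj_sub, proj_reprc]

/-- The product kernel is differentiable with the stated derivative. [folklore] -/
theorem hasFDerivAt_stProdKernel (hη : ContDiff ℝ 1 η) (hk : IsContDiff 1 k)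
    (q : ℝ × EuclideanSpace ℝ d) : HasFDerivAt (stProdKernel η k) (stProdKernelDeriv η k q) q := by
  have h1 : HasFDerivAt (fun q : ℝ × EuclideanSpace ℝ d => η q.1)
      (deriv η q.1 • ContinuousLinearMap.fst ℝ ℝ (EuclideanSpace ℝ d)) q := by
    have hd : HasDerivAt η (deriv η q.1) q.1 := ((hη.differentiable one_ne_zero) q.1).hasDerivAt
    have := hd.hasFDerivAt.comp q hasFDerivAt_fst
    refine this.congr_fderiv ?_
    refine ContinuousLinearMap.ext fun v => ?_
    simp [mul_comm]
  have h2 : HasFDerivAt (fun q : ℝ × EuclideanSpace ℝ d => lift k q.2)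
      ((_root_.fderiv ℝ (lift k) q.2).comp (ContinuousLinearMap.snd ℝ ℝ (EuclideanSpace ℝ d))) q :=
    ((ContDiff.differentiable hk one_ne_zero) q.2).hasFDerivAt.comp q hasFDerivAt_snd
  have h := h1.mul h2
  exact h

/-- The derivative of the product kernel is bounded (compact support in time, compact torus in
space). [folklore] -/
theorem exists_norm_stProdKernelDeriv_le (hη : ContDiff ℝ 1 η) (hηc : HasCompactSupport η)
    (hk : IsContDiff 1 k) : ∃ C, ∀ q, ‖stProdKernelDeriv (d := d) η k q‖ ≤ C := by
  obtain ⟨A₀, hA₀⟩ := hη.continuous.bounded_above_of_compact_support hηc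
  obtain ⟨A₁, hA₁⟩ := (hη.continuous_deriv le_rfl).bounded_above_of_compact_support hηc.deriv
  obtain ⟨B₀, hB₀⟩ := exists_forall_norm_le_of_continuous hk.continuous
  obtain ⟨B₁, hB₁⟩ := exists_forall_norm_le_of_continuous hk.continuous_fderiv
  have hA₀' : 0 ≤ A₀ := (norm_nonneg _).trans (hA₀ 0)
  have hA₁' : 0 ≤ A₁ := (norm_nonneg _).trans (hA₁ 0)
  refine ⟨A₀ * B₁ + B₀ * A₁, fun q => ?_⟩
  unfold stProdKernelDeriv
  refine (norm_add_le _ _).trans (add_le_add ?_ ?_)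
  · rw [norm_smul]
    refine mul_le_mul (hA₀ _) ?_ (norm_nonneg _) hA₀'
    refine (ContinuousLinearMap.opNorm_comp_le _ _).trans ?_
    rw [fderiv_lift]
    calc ‖Torus.fderiv k (proj q.2)‖ * ‖ContinuousLinearMap.snd ℝ ℝ (EuclideanSpace ℝ d)‖
        ≤ B₁ * 1 := mul_le_mul (hB₁ _) (ContinuousLinearMap.norm_snd_le ..) (norm_nonneg _)
          ((norm_nonneg _).trans (hB₁ 0))
      _ = B₁ := mul_one _
  · rw [norm_smul, lift_apply]
    refine mul_le_mul (hB₀ _) ?_ (norm_nonneg _) ((norm_nonneg _).trans (hB₀ 0))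
    rw [norm_smul]
    calc ‖deriv η q.1‖ * ‖ContinuousLinearMap.fst ℝ ℝ (EuclideanSpace ℝ d)‖
        ≤ A₁ * 1 := mul_le_mul (hA₁ _) (ContinuousLinearMap.norm_fst_le ..) (norm_nonneg _) hA₁'
      _ = A₁ := mul_one _

omit [Fintype d] in
/-- The product kernel is bounded. [folklore] -/
theorem exists_norm_stProdKernel_le (hη : Continuous η) (hηc : HasCompactSupport η) (hk : Continuous k) :
    ∃ C, ∀ q, ‖stProdKernel (d := d) η k q‖ ≤ C := by
  obtain ⟨A₀, hA₀⟩ := hη.bounded_above_of_compact_support hηc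
  obtain ⟨B₀, hB₀⟩ := exists_forall_norm_le_of_continuous hk
  refine ⟨A₀ * B₀, fun q => ?_⟩
  rw [stProdKernel, norm_mul, lift_apply]
  exact mul_le_mul (hA₀ _) (hB₀ _) (norm_nonneg _) ((norm_nonneg _).trans (hA₀ 0))

omit [Fintype d] in
/-- The product kernel is continuous. [folklore] -/
theorem continuous_stProdKernel (hη : Continuous η) (hk : Continuous k) : Continuous (stProdKernel (d := d) η k) :=
  (hη.comp continuous_fst).mul ((continuous_lift_iff.2 hk).comp continuous_snd)

/-- The derivative of the product kernel is continuous. [folklore] -/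
theorem continuous_stProdKernelDeriv (hη : ContDiff ℝ 1 η) (hk : IsContDiff 1 k) :
    Continuous (stProdKernelDeriv (d := d) η k) := by
  unfold stProdKernelDeriv
  refine Continuous.add ?_ ?_
  · refine (hη.continuous.comp continuous_fst).smul ?_
    exact ((ContDiff.continuous_fderiv hk one_ne_zero).comp continuous_snd).clm_comp continuous_const
  · refine ((continuous_lift_iff.2 hk.continuous).comp continuous_snd).smul ?_
    exact ((hη.continuous_deriv le_rfl).comp continuous_fst).smul continuous_const

/-- The embedding `(s, z) ↦ (s, reprc z)` of `ℝ × T^d` into `ℝ × ℝ^d` is measurable. [folklore] -/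
theorem measurable_stEmbed :
    Measurable fun p : ℝ × UnitAddTorus d => ((p.1, reprc p.2) : ℝ × EuclideanSpace ℝ d) :=
  measurable_fst.prodMk (measurable_reprc.comp measurable_snd)

/-- **Differentiation under the integral sign for space–time mollifications.** For
`F ∈ L¹(ℝ × T^d)`, `η ∈ C¹_c(ℝ)` and `k ∈ C¹(T^d)`, the space–time lift of `stConv η k F` is
differentiable with derivative `∫ F(p) • Dκ(q - ι p) dp`, `κ` the product kernel
(Mathlib's `hasFDerivAt_integral_of_dominated_of_fderiv_le`). [folklore] -/
theorem hasFDerivAt_stLift_stConv (hF : Integrable F ((volume : Measure ℝ).prod volume))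
    (hη : ContDiff ℝ 1 η) (hηc : HasCompactSupport η) (hk : IsContDiff 1 k)
    (q : ℝ × EuclideanSpace ℝ d) :
    HasFDerivAt (stLift (stConv η k F))
      (∫ p, F p • stProdKernelDeriv η k (q - (p.1, reprc p.2)) ∂((volume : Measure ℝ).prod volume)) q := by
  obtain ⟨C, hC⟩ := exists_norm_stProdKernelDeriv_le (d := d) hη hηc hk
  obtain ⟨C₀, hC₀⟩ := exists_norm_stProdKernel_le (d := d) hη.continuous hηc hk.continuous
  have hκc : Continuous (stProdKernel (d := d) η k) := continuous_stProdKernel hη.continuous hk.continuous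
  have hκ'c : Continuous (stProdKernelDeriv (d := d) η k) := continuous_stProdKernelDeriv hη hk
  rw [stLift_stConv]
  set ι : ℝ × UnitAddTorus d → ℝ × EuclideanSpace ℝ d := fun p => (p.1, reprc p.2) with hι
  have hιm : Measurable ι := measurable_stEmbed
  have hmeas : ∀ q : ℝ × EuclideanSpace ℝ d, AEStronglyMeasurable
      (fun p : ℝ × UnitAddTorus d => F p * stProdKernel η k (q - ι p))
      ((volume : Measure ℝ).prod volume) := fun q =>
    hF.aestronglyMeasurable.mul
      ((hκc.measurable.comp (measurable_const.sub hιm)).aestronglyMeasurable)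
  refine hasFDerivAt_integral_of_dominated_of_fderiv_le (bound := fun p => ‖F p‖ * C)
    (F' := fun q p => F p • stProdKernelDeriv η k (q - ι p)) univ_mem ?_ ?_ ?_ ?_ ?_ ?_
  · exact Eventually.of_forall hmeas
  · exact hF.mul_bdd (hκc.measurable.comp (measurable_const.sub hιm)).aestronglyMeasurable
      (Eventually.of_forall fun p => hC₀ _)
  · exact hF.aestronglyMeasurable.smul
      ((hκ'c.measurable.comp (measurable_const.sub hιm)).aestronglyMeasurable)
  · refine Eventually.of_forall fun p q' _ => ?_
    rw [norm_smul]
    exact mul_le_mul_of_nonneg_left (hC _) (norm_nonneg _)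
  · exact hF.norm.mul_const C
  · refine Eventually.of_forall fun p q' _ => ?_
    have h := (hasFDerivAt_stProdKernel hη hk (q' - ι p)).comp q' ((hasFDerivAt_id q').sub_const (ι p))
    rw [ContinuousLinearMap.comp_id] at h
    exact h.const_mul (F p)

/-- The directional derivatives of the lifted space–time mollification are again (lifted)
space–time mollifications: `D(stLift M)(q)(τ, v) = stLift (stConv η (∂ᵥk) F)(q) +
τ · stLift (stConv η' k F)(q)` with the directional derivative `∂ᵥ k = lineDeriv k · v`. [folklore] -/
theorem fderiv_stLift_stConv_apply (hF : Integrable F ((volume : Measure ℝ).prod volume))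
    (hη : ContDiff ℝ 1 η) (hηc : HasCompactSupport η) (hk : IsContDiff 1 k)
    (q : ℝ × EuclideanSpace ℝ d) (V : ℝ × EuclideanSpace ℝ d) :
    _root_.fderiv ℝ (stLift (stConv η k F)) q V =
      stLift (stConv η (fun z => lineDeriv k z V.2) F) q +
        V.1 * stLift (stConv (deriv η) k F) q := by
  obtain ⟨C, hC⟩ := exists_norm_stProdKernelDeriv_le (d := d) hη hηc hk
  have hκ'c : Continuous (stProdKernelDeriv (d := d) η k) := continuous_stProdKernelDeriv hη hk
  set ι : ℝ × UnitAddTorus d → ℝ × EuclideanSpace ℝ d := fun p => (p.1, reprc p.2) with hι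
  have hιm : Measurable ι := measurable_stEmbed
  have hint : Integrable (fun p => F p • stProdKernelDeriv η k (q - ι p))
      ((volume : Measure ℝ).prod volume) :=
    (hF.norm.mul_const C).mono' (hF.aestronglyMeasurable.smul
      ((hκ'c.measurable.comp (measurable_const.sub hιm)).aestronglyMeasurable))
      (Eventually.of_forall fun p => by
        rw [norm_smul]
        exact mul_le_mul_of_nonneg_left (hC _) (norm_nonneg _))
  rw [(hasFDerivAt_stLift_stConv hF hη hηc hk q).fderiv]
  change (∫ p, F p • stProdKernelDeriv η k (q - ι p) ∂((volume : Measure ℝ).prod volume)) V = _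
  rw [ContinuousLinearMap.integral_apply hint]
  -- split the integrand
  have hk1 := hk
  have hsplit : ∀ p : ℝ × UnitAddTorus d, (F p • stProdKernelDeriv η k (q - ι p)) V =
      F p * (η (q.1 - p.1) * lineDeriv k (proj q.2 - p.2) V.2) +
        V.1 * (F p * (deriv η (q.1 - p.1) * k (proj q.2 - p.2))) := by
    intro p
    simp only [hι, stProdKernelDeriv, FunLike.coe_smul, add_apply,
      Pi.smul_apply, ContinuousLinearMap.comp_apply, ContinuousLinearMap.coe_snd',
      ContinuousLinearMap.coe_fst', Prod.fst_sub, Prod.snd_sub, smul_eq_mul, fderiv_lift, proj_sub,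
      proj_reprc, lift_apply, lineDeriv_eq_fderiv_apply hk1]
    ring
  simp_rw [hsplit]
  -- integrability of the two pieces
  obtain ⟨A₀, hA₀⟩ := hη.continuous.bounded_above_of_compact_support hηc
  obtain ⟨A₁, hA₁⟩ := (hη.continuous_deriv le_rfl).bounded_above_of_compact_support hηc.deriv
  have hkV : Continuous fun z => lineDeriv k z V.2 := by
    have : (fun z => lineDeriv k z V.2) = fun z => Torus.fderiv k z V.2 :=
      funext fun z => lineDeriv_eq_fderiv_apply hk1 z V.2
    rw [this]
    exact hk.continuous_fderiv.clm_apply continuous_const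
  obtain ⟨B, hB⟩ := exists_forall_norm_le_of_continuous hkV
  obtain ⟨B₀, hB₀⟩ := exists_forall_norm_le_of_continuous hk.continuous
  have hm1 : AEStronglyMeasurable (fun p : ℝ × UnitAddTorus d =>
      η (q.1 - p.1) * lineDeriv k (proj q.2 - p.2) V.2) ((volume : Measure ℝ).prod volume) :=
    ((hη.continuous.comp (continuous_const.sub continuous_fst)).mul
      (hkV.comp (continuous_const.sub continuous_snd))).aestronglyMeasurable
  have hm2 : AEStronglyMeasurable (fun p : ℝ × UnitAddTorus d =>
      deriv η (q.1 - p.1) * k (proj q.2 - p.2)) ((volume : Measure ℝ).prod volume) :=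
    (((hη.continuous_deriv le_rfl).comp (continuous_const.sub continuous_fst)).mul
      (hk.continuous.comp (continuous_const.sub continuous_snd))).aestronglyMeasurable
  have hi1 : Integrable (fun p : ℝ × UnitAddTorus d =>
      F p * (η (q.1 - p.1) * lineDeriv k (proj q.2 - p.2) V.2)) ((volume : Measure ℝ).prod volume) :=
    hF.mul_bdd hm1 (Eventually.of_forall fun p => by
      rw [norm_mul]
      exact mul_le_mul (hA₀ _) (hB _) (norm_nonneg _) ((norm_nonneg _).trans (hA₀ 0)))
  have hi2 : Integrable (fun p : ℝ × UnitAddTorus d =>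
      F p * (deriv η (q.1 - p.1) * k (proj q.2 - p.2))) ((volume : Measure ℝ).prod volume) :=
    hF.mul_bdd hm2 (Eventually.of_forall fun p => by
      rw [norm_mul]
      exact mul_le_mul (hA₁ _) (hB₀ _) (norm_nonneg _) ((norm_nonneg _).trans (hA₁ 0)))
  rw [integral_add hi1 (hi2.const_mul _), MeasureTheory.integral_const_mul]
  rfl

/-- **Space–time mollifications are smooth**: for `F ∈ L¹(ℝ × T^d)`, `η ∈ C_c^∞(ℝ)` and smooth
`k` on `T^d`, the space–time lift of `stConv η k F` is `C^n` for every `n` (induction on `n`, the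
directional derivatives being space–time mollifications with the kernels `(η, ∂ᵥk)` and
`(η', k)`; Mathlib's `contDiff_succ_iff_fderiv_apply`). [folklore] -/
theorem contDiff_stLift_stConv (hF : Integrable F ((volume : Measure ℝ).prod volume)) :
    ∀ (n : ℕ) {η : ℝ → ℝ} {k : UnitAddTorus d → ℝ}, ContDiff ℝ ∞ η → HasCompactSupport η →
      IsSmooth k → ContDiff ℝ n (stLift (stConv η k F))
  | 0, η, k, hη, hηc, hk => by
    rw [Nat.cast_zero, contDiff_zero]
    exact continuous_iff_continuousAt.2 fun q =>
      (hasFDerivAt_stLift_stConv hF (hη.of_le (by norm_cast)) hηc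
        (hk.isContDiff (by simp)) q).continuousAt
  | n + 1, η, k, hη, hηc, hk => by
    have hη1 : ContDiff ℝ 1 η := hη.of_le (by norm_cast)
    have hk1 : IsContDiff 1 k := hk.isContDiff (by simp)
    rw [Nat.cast_succ, contDiff_succ_iff_fderiv_apply]
    refine ⟨fun q => (hasFDerivAt_stLift_stConv hF hη1 hηc hk1 q).differentiableAt, fun h => ?_,
      fun V => ?_⟩
    · exact absurd h (by exact_mod_cast WithTop.coe_ne_top)
    · have h : (fun q => _root_.fderiv ℝ (stLift (stConv η k F)) q V) =
          fun q => stLift (stConv η (fun z => lineDeriv k z V.2) F) q +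
            V.1 * stLift (stConv (deriv η) k F) q :=
        funext fun q => fderiv_stLift_stConv_apply hF hη1 hηc hk1 q V
      rw [h]
      exact (contDiff_stLift_stConv hF n hη hηc (hk.lineDeriv V.2)).add
        (contDiff_const.mul (contDiff_stLift_stConv hF n
          (hη.deriv') hηc.deriv hk))

/-- Space–time mollifications have smooth space–time lifts (`C^∞`). [folklore] -/
theorem contDiff_top_stLift_stConv (hF : Integrable F ((volume : Measure ℝ).prod volume))
    (hη : ContDiff ℝ ∞ η) (hηc : HasCompactSupport η) (hk : IsSmooth k) :
    ContDiff ℝ ∞ (stLift (stConv η k F)) :=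
  contDiff_infty.2 fun n => contDiff_stLift_stConv hF n hη hηc hk

omit [Fintype d] in
/-- The directional derivative along the zero vector vanishes. [folklore] -/
theorem lineDeriv_zero_right (f : UnitAddTorus d → ℝ) (z : UnitAddTorus d) : lineDeriv f z 0 = 0 := by
  simp [Torus.lineDeriv]

/-- Mollification with the zero kernel in space vanishes. [folklore] -/
theorem stConv_zero_kernel (η : ℝ → ℝ) (F : ℝ × UnitAddTorus d → ℝ) :
    stConv η (fun _ : UnitAddTorus d => (0 : ℝ)) F = 0 := by
  funext t x
  simp [stConv]

/-- **Time derivative of a space–time mollification**: `∂ₜ (stConv η k F) = stConv η' k F`. [folklore] -/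
theorem timeDeriv_stConv (hF : Integrable F ((volume : Measure ℝ).prod volume))
    (hη : ContDiff ℝ 1 η) (hηc : HasCompactSupport η) (hk : IsContDiff 1 k) (t : ℝ)
    (x : UnitAddTorus d) : timeDeriv (stConv η k F) t x = stConv (deriv η) k F t x := by
  obtain ⟨y, rfl⟩ := proj_surjective x
  -- the time slice through `(t, y)` as a path in `ℝ × ℝ^d`
  have hpath : HasDerivAt (fun τ : ℝ => ((τ, y) : ℝ × EuclideanSpace ℝ d)) (1, 0) t :=
    (hasDerivAt_id t).prodMk (hasDerivAt_const t y)
  have h := (hasFDerivAt_stLift_stConv hF hη hηc hk (t, y)).comp_hasDerivAt t hpath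
  have hfun : (stLift (stConv η k F) ∘ fun τ : ℝ => ((τ, y) : ℝ × EuclideanSpace ℝ d)) =
      fun τ => stConv η k F τ (proj y) := by
    funext τ
    rfl
  rw [hfun] at h
  rw [timeDeriv, h.deriv, ← (hasFDerivAt_stLift_stConv hF hη hηc hk (t, y)).fderiv,
    fderiv_stLift_stConv_apply hF hη hηc hk]
  simp only [lineDeriv_zero_right, stConv_zero_kernel, one_mul]
  simp [stLift]

/-- **Space derivatives of a space–time mollification**: `∂ᵢ (stConv η k F)(t, ·) = stConv η (∂ᵢk) F (t, ·)`. [folklore] -/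
theorem partialDeriv_stConv (hF : Integrable F ((volume : Measure ℝ).prod volume))
    (hη : ContDiff ℝ 1 η) (hηc : HasCompactSupport η) (hk : IsContDiff 1 k) [DecidableEq d]
    (i : d) (t : ℝ) (x : UnitAddTorus d) :
    partialDeriv i (stConv η k F t) x = stConv η (partialDeriv i k) F t x := by
  obtain ⟨y, rfl⟩ := proj_surjective x
  set e : EuclideanSpace ℝ d := EuclideanSpace.single i 1 with he
  have hpath : HasDerivAt (fun τ : ℝ => ((t, y + τ • e) : ℝ × EuclideanSpace ℝ d)) (0, e) 0 := by
    refine (hasDerivAt_const 0 t).prodMk ?_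
    have : HasDerivAt (fun τ : ℝ => y + τ • e) (0 + (1 : ℝ) • e) 0 :=
      (hasDerivAt_const 0 y).add ((hasDerivAt_id 0).smul_const e)
    simpa using this
  have h := (hasFDerivAt_stLift_stConv hF hη hηc hk (t, y + (0 : ℝ) • e)).comp_hasDerivAt 0 hpath
  have hfun : (stLift (stConv η k F) ∘ fun τ : ℝ => ((t, y + τ • e) : ℝ × EuclideanSpace ℝ d)) =
      fun τ => stConv η k F t (proj y + proj (τ • e)) := by
    funext τ
    simp [stLift]
  rw [hfun] at h
  rw [partialDeriv, Torus.lineDeriv, ← he, h.deriv, zero_smul, add_zero,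
    ← (hasFDerivAt_stLift_stConv hF hη hηc hk (t, y)).fderiv, fderiv_stLift_stConv_apply hF hη hηc hk]
  simp only [zero_mul, add_zero]
  rfl

end SpaceTimeConv

/-! ## Derivatives move across a mollification; divergence of mollified smooth fields -/

section MoveDeriv

variable [DecidableEq d]

/-- **Integration by parts inside a mollification**: for smooth `f` and a smooth kernel `K`,
`f ⋆ ∂ᵢK = (∂ᵢ f) ⋆ K` (`∂ᵢ[K(x - ·)] = -(∂ᵢK)(x - ·)` and `∫ ∂ᵢ(f · K(x - ·)) = 0` on `T^d`). [folklore] -/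
theorem convolution_partialDeriv_right {f K : UnitAddTorus d → ℝ} (hf : IsSmooth f) (hK : IsSmooth K)
    (i : d) (x : UnitAddTorus d) :
    (f ⋆ partialDeriv i K) x = (partialDeriv i f ⋆ K) x := by
  have hK1 : IsContDiff 1 K := hK.isContDiff (by simp)
  have hf1 : IsContDiff 1 f := hf.isContDiff (by simp)
  have hKx : IsSmooth fun y => K (x - y) := hK.comp_sub_left x
  have hKx1 : IsContDiff 1 fun y => K (x - y) := hKx.isContDiff (by simp)
  -- `∫ ∂ᵢ (f · K(x - ·)) = 0`
  have h0 := integral_partialDeriv_eq_zero_holds (hf.smul' hKx) i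
  have hprod : ∀ y, partialDeriv i (fun y => f y • K (x - y)) y =
      f y * (-partialDeriv i K (x - y)) + partialDeriv i f y * K (x - y) := by
    intro y
    have := partialDeriv_mul hf1 hKx1 i y
    simp only [smul_eq_mul] at this ⊢
    rw [this, partialDeriv_comp_sub_left hK1]
  simp_rw [hprod] at h0
  have i1 : Integrable (fun y => f y * (-partialDeriv i K (x - y))) volume :=
    ((hf.continuous.mul ((hK.partialDeriv i).continuous.comp
      (continuous_const.sub continuous_id)).neg)).integrable_unitAddTorus
  have i2 : Integrable (fun y => partialDeriv i f y * K (x - y)) volume :=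
    (((hf.partialDeriv i).continuous).mul (hK.continuous.comp
      (continuous_const.sub continuous_id))).integrable_unitAddTorus
  rw [integral_add i1 i2] at h0
  rw [convolution_lsmul, convolution_lsmul]
  simp only [smul_eq_mul]
  have hneg : ∫ y, f y * (-partialDeriv i K (x - y)) = -∫ y, f y * partialDeriv i K (x - y) := by
    rw [← integral_neg]
    exact integral_congr_ae (Eventually.of_forall fun y => by ring)
  rw [hneg] at h0
  linarith

omit [DecidableEq d] in
/-- Mollification of a finite sum of integrable functions. [folklore] -/
theorem finset_sum_convolution {ι : Type*} (s : Finset ι) {g : ι → UnitAddTorus d → ℝ}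
    (hg : ∀ i ∈ s, Integrable (g i) volume) {K : UnitAddTorus d → ℝ} (hK : Continuous K)
    (x : UnitAddTorus d) : ((fun y => ∑ i ∈ s, g i y) ⋆ K) x = ∑ i ∈ s, (g i ⋆ K) x := by
  simp only [convolution_lsmul, Finset.sum_smul]
  rw [integral_finsetSum _ fun i hi => integrable_smul_comp_sub (hg i hi) hK x]

/-- **Mollifying a smooth divergence-free field gives a divergence-free field**:
`div (w ⋆ K) = ∑ᵢ wᵢ ⋆ ∂ᵢK = ∑ᵢ (∂ᵢwᵢ) ⋆ K = (div w) ⋆ K = 0`. [folklore] -/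
theorem IsDivFree.vecConv {w : UnitAddTorus d → EuclideanSpace ℝ d} (hw : IsSmooth w)
    (hdiv : IsDivFree w) {K : UnitAddTorus d → ℝ} (hK : IsSmooth K) :
    IsDivFree (fun x => WithLp.toLp 2 fun i => ((fun y => w y i) ⋆ K) x) := by
  intro x
  unfold divergence
  have h1 : ∀ i, partialDeriv i (fun y => (WithLp.toLp 2 fun i => ((fun y' => w y' i) ⋆ K) y) i) x =
      ((partialDeriv i fun y => w y i) ⋆ K) x := by
    intro i
    have hfun : (fun y => (WithLp.toLp 2 fun i => ((fun y' => w y' i) ⋆ K) y) i) =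
        ((fun y' => w y' i) ⋆ K) := rfl
    rw [hfun, partialDeriv_convolution (hw.apply i).integrable hK,
      convolution_partialDeriv_right (hw.apply i) hK]
  simp_rw [h1]
  rw [← finset_sum_convolution _ (fun i _ => ((hw.apply i).partialDeriv i).integrable) hK.continuous]
  have hdiv' : (fun y => ∑ i, partialDeriv i (fun y => w y i) y) = fun _ => 0 := funext hdiv
  rw [hdiv']
  simp [convolution_lsmul]

end MoveDeriv

/-! ## Time mollification versus space mollification (Fubini identities) -/

section TimeSpace

/-- **Time mollification commutes with space mollification.** For `G ∈ L¹(ℝ × T^d)`, a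
continuous time kernel `ρ` with compact support and a continuous space kernel `K`:
`(ρ ⋆ₜ (s ↦ (G(s) ⋆ₓ K)(x)))(t) = ((y ↦ (ρ ⋆ₜ G(·, y))(t)) ⋆ₓ K)(x)` (Fubini on `ℝ × T^d`). [folklore] -/
theorem timeConv_spaceConv_comm {G : ℝ → UnitAddTorus d → ℝ}
    (hG : Integrable (uncurry G) ((volume : Measure ℝ).prod volume)) {ρ : ℝ → ℝ}
    (hρ : Continuous ρ) (hρc : HasCompactSupport ρ) {K : UnitAddTorus d → ℝ} (hK : Continuous K)
    (t : ℝ) (x : UnitAddTorus d) :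
    (ρ ⋆ fun s => (G s ⋆ K) x) t = ((fun y => (ρ ⋆ fun s => G s y) t) ⋆ K) x := by
  obtain ⟨A, hA⟩ := hρ.bounded_above_of_compact_support hρc
  obtain ⟨B, hB⟩ := exists_forall_norm_le_of_continuous hK
  -- the integrand on `ℝ × T^d`, variables `(τ, y)`: `ρ τ G (t - τ) y K (x - y)`
  set Φ : ℝ × UnitAddTorus d → ℝ := fun p => ρ p.1 * G (t - p.1) p.2 * K (x - p.2) with hΦ
  -- integrability: `(τ, y) ↦ G (t - τ, y)` is integrable (measure-preserving reflection in time)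
  have hG' : Integrable (fun p : ℝ × UnitAddTorus d => G (t - p.1) p.2)
      ((volume : Measure ℝ).prod volume) := by
    have hmp : MeasurePreserving (fun p : ℝ × UnitAddTorus d => (t - p.1, p.2))
        ((volume : Measure ℝ).prod volume) ((volume : Measure ℝ).prod volume) :=
      ((volume : Measure ℝ).measurePreserving_sub_left t).prod (MeasurePreserving.id volume)
    have := (hmp.integrable_comp hG.aestronglyMeasurable).2 hG
    exact this
  have hΦi : Integrable Φ ((volume : Measure ℝ).prod volume) := by
    have h1 : Integrable (fun p : ℝ × UnitAddTorus d => ρ p.1 * G (t - p.1) p.2)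
        ((volume : Measure ℝ).prod volume) :=
      hG'.bdd_mul (hρ.comp_aestronglyMeasurable (measurable_fst.aestronglyMeasurable))
        (Eventually.of_forall fun p => hA _)
    exact h1.mul_bdd (hK.comp_aestronglyMeasurable ((measurable_const.sub measurable_snd).aestronglyMeasurable))
      (Eventually.of_forall fun p => hB _)
  calc (ρ ⋆ fun s => (G s ⋆ K) x) t = ∫ τ, ∫ y, Φ (τ, y) := by
        rw [convolution_lsmul]
        refine integral_congr_ae (Eventually.of_forall fun τ => ?_)
        simp only [smul_eq_mul, convolution_lsmul, ← integral_const_mul, hΦ]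
        refine integral_congr_ae (Eventually.of_forall fun y => ?_)
        ring
    _ = ∫ y, ∫ τ, Φ (τ, y) := integral_integral_swap hΦi
    _ = ((fun y => (ρ ⋆ fun s => G s y) t) ⋆ K) x := by
        rw [convolution_lsmul]
        refine integral_congr_ae (Eventually.of_forall fun y => ?_)
        simp only [smul_eq_mul, convolution_lsmul, ← integral_mul_const, hΦ]

/-- `Torus.timeConv_spaceConv_comm` through the tree's `timeAvgWith` (`TorusMollifiedFields`):
time averaging commutes with space mollification,
`timeAvgWith ρ (fun s => G s ⋆ K) t x = ((timeAvgWith ρ G t) ⋆ K) x` — componentwise this is the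
shape of `mollifiedField_apply` there. [folklore] -/
theorem timeAvgWith_convolution_comm {G : ℝ → UnitAddTorus d → ℝ}
    (hG : Integrable (uncurry G) ((volume : Measure ℝ).prod volume)) {ρ : ℝ → ℝ}
    (hρ : Continuous ρ) (hρc : HasCompactSupport ρ) {K : UnitAddTorus d → ℝ} (hK : Continuous K)
    (t : ℝ) (x : UnitAddTorus d) :
    timeAvgWith ρ (fun s y => (G s ⋆ K) y) t x = ((timeAvgWith ρ G t) ⋆ K) x := by
  simp only [timeAvgWith]
  exact timeConv_spaceConv_comm hG hρ hρc hK t x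

/-- **A space–time mollification is a time mollification of space mollifications**:
`stConv ρ K F (t, x) = (ρ ⋆ₜ (s ↦ (F(s, ·) ⋆ₓ K)(x)))(t)` for `F ∈ L¹(ℝ × T^d)` (Fubini, and the
reflection `s = t - τ` in time). [folklore] -/
theorem stConv_eq_timeConv {F : ℝ × UnitAddTorus d → ℝ}
    (hF : Integrable F ((volume : Measure ℝ).prod volume)) {ρ : ℝ → ℝ} (hρ : Continuous ρ)
    (hρc : HasCompactSupport ρ) {K : UnitAddTorus d → ℝ} (hK : Continuous K) (t : ℝ)
    (x : UnitAddTorus d) :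
    stConv ρ K F t x = (ρ ⋆ fun s => ((fun z => F (s, z)) ⋆ K) x) t := by
  obtain ⟨A, hA⟩ := hρ.bounded_above_of_compact_support hρc
  obtain ⟨B, hB⟩ := exists_forall_norm_le_of_continuous hK
  have hΦi : Integrable (fun p : ℝ × UnitAddTorus d => F p * (ρ (t - p.1) * K (x - p.2)))
      ((volume : Measure ℝ).prod volume) := by
    refine hF.mul_bdd (c := A * B) ?_ (Eventually.of_forall fun p => ?_)
    · exact ((hρ.comp (continuous_const.sub continuous_fst)).mul
        (hK.comp (continuous_const.sub continuous_snd))).aestronglyMeasurable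
    · rw [norm_mul]
      exact mul_le_mul (hA _) (hB _) (norm_nonneg _) ((norm_nonneg _).trans (hA 0))
  rw [stConv, integral_prod _ hΦi, convolution_lsmul]
  -- reflect the time variable: `∫ s, g (t - s) ... = ∫ τ, g τ ...`
  have hrefl : ∫ s, ∫ z, F (s, z) * (ρ (t - s) * K (x - z)) =
      ∫ τ, ∫ z, F (t - τ, z) * (ρ τ * K (x - z)) := by
    rw [← integral_sub_left_eq_self _ volume t]
    refine integral_congr_ae (Eventually.of_forall fun τ => ?_)
    simp only [sub_sub_cancel]
  rw [hrefl]
  refine integral_congr_ae (Eventually.of_forall fun τ => ?_)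
  simp only [smul_eq_mul, convolution_lsmul, ← integral_const_mul]
  refine integral_congr_ae (Eventually.of_forall fun z => ?_)
  ring

/-- `Torus.stConv_eq_timeConv` through the tree's `timeAvgWith` (`TorusMollifiedFields`):
`stConv ρ K F t x = timeAvgWith ρ (fun s => F(s, ·) ⋆ K) t x`. [folklore] -/
theorem stConv_eq_timeAvgWith {F : ℝ × UnitAddTorus d → ℝ}
    (hF : Integrable F ((volume : Measure ℝ).prod volume)) {ρ : ℝ → ℝ} (hρ : Continuous ρ)
    (hρc : HasCompactSupport ρ) {K : UnitAddTorus d → ℝ} (hK : Continuous K) (t : ℝ)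
    (x : UnitAddTorus d) :
    stConv ρ K F t x = timeAvgWith ρ (fun s y => ((fun z => F (s, z)) ⋆ K) y) t x := by
  rw [stConv_eq_timeConv hF hρ hρc hK t x]
  rfl

end TimeSpace

/-! ## The energy chain rule for a field that is smooth and bounded in time -/

section ChainRule

/-- **Chain rule for the square integral.** If `s ↦ V s x` is differentiable with derivative
`V' s x` for every `x`, with `V`, `V'` uniformly bounded and measurable in `x`, then
`s ↦ ∫ (V s x)² dx` is differentiable with derivative `∫ 2 V s x · V' s x dx` (differentiation
under the integral sign over the compact torus, Mathlib's
`hasDerivAt_integral_of_dominated_loc_of_deriv_le`). The *global-in-time* bounds (rather than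
the local ones of the accepted `Torus.hasDerivWithinAt_integral_of_convex`,
`FluidPDE/TorusCalculusProofs`) are what the consumer has at hand: `V = stConv η k F` and
`V' = stConv η' k F` with `η ∈ C_c(ℝ)` are globally bounded (`Torus.stConv`, `F ∈ L¹`).
[folklore] -/
theorem hasDerivAt_integral_sq {V V' : ℝ → UnitAddTorus d → ℝ}
    (hderiv : ∀ x s, HasDerivAt (fun s => V s x) (V' s x) s)
    {M : ℝ} (hV : ∀ s x, |V s x| ≤ M) (hV' : ∀ s x, |V' s x| ≤ M)
    (hm : ∀ s, AEStronglyMeasurable (V s) volume) (hm' : ∀ s, AEStronglyMeasurable (V' s) volume)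
    (s₀ : ℝ) :
    HasDerivAt (fun s => ∫ x, V s x ^ 2) (∫ x, 2 * V s₀ x * V' s₀ x) s₀ := by
  have hM : 0 ≤ M := (abs_nonneg _).trans (hV s₀ 0)
  have h := hasDerivAt_integral_of_dominated_loc_of_deriv_le (μ := (volume : Measure (UnitAddTorus d)))
    (F := fun s x => V s x ^ 2) (F' := fun s x => 2 * V s x * V' s x) (x₀ := s₀)
    (bound := fun _ => 2 * M * M) (s := univ) univ_mem ?_ ?_ ?_ ?_ ?_ ?_
  · exact h.2
  · exact Eventually.of_forall fun s => (hm s).pow 2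
  · refine Integrable.of_bound (C := M ^ 2) ((hm s₀).pow 2) (Eventually.of_forall fun x => ?_)
    rw [Real.norm_eq_abs, abs_pow]
    exact pow_le_pow_left₀ (abs_nonneg _) (hV s₀ x) 2
  · exact ((hm s₀).const_mul 2).mul (hm' s₀)
  · refine Eventually.of_forall fun x s _ => ?_
    rw [Real.norm_eq_abs, abs_mul, abs_mul, abs_two]
    exact mul_le_mul (mul_le_mul_of_nonneg_left (hV s x) zero_le_two) (hV' s x) (abs_nonneg _)
      (by positivity)
  · exact integrable_const _
  · refine Eventually.of_forall fun x s _ => ?_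
    have h2 := (hderiv x s).pow 2
    simp only [Nat.cast_ofNat] at h2
    have h3 : (2 : ℝ) * V s x * V' s x = 2 * V s x ^ 1 * V' s x := by rw [pow_one]
    rw [h3]
    exact h2

end ChainRule

end Torus

end Literature.Analysis.FunctionSpaces
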